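import Summits.BirchSwinnertonDyer.BirchSwinnertonDyer.Theorems.RamifiedSevenEllipticUnitsValueOfKMCImpReading
import Summits.BirchSwinnertonDyer.BirchSwinnertonDyer.Theorems.InertBadSignedBranchesCccOneOfKMCImpReading
import Summits.BirchSwinnertonDyer.Rank1Residual.Additive.KatoDescentClosedBindersContra
import HarnessLib

set_option autoImplicit false

/-!
# The image-free Kato descent at a torsion-free rank-one member with the count reading and the realisation
# taken POINTWISE at the pair `(W, p)` — and the two crux compositions (19945 `EllipticUnitValueSevenOfGZK`,
# 19223 `CccOneLawOnTypeIstarZero`) re-keyed to a ROW-RESTRICTED count hypothesis (cell `bsd-cm`, seat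
# `bsd-cm-prr-ty1` g16, planner GO D679 «E50»; serves stmt-BirchSwinnertonDyer-19945 and its twin
# stmt-BirchSwinnertonDyer-19223; filed under `Rank1Residual/Additive/` because `Theorems/` is prover-only (D-0016) and this
# seat is a literature-prover — the declarations live in the records' namespaces; theorems only; nothing asserted, no item closed)

WHY THIS FILE.  The Kato–Perrin-Riou skeletons v4 conclude the two cruxes through the records
`ValueOfKMCImpReading.valueSevenOfGZK_of_kmcImp_of_perrinRiou` (19945) and
`CccOneKMCImpReading.cccOneLawOnTypeIstarZero_of_kmcImp_of_perrinRiou` (19223), whose hypothesis `hC` is the GENERIC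
schema `TorsionFree.RankOneCountReading IsOf PRRatio` (stub 3: every `W`, every `p`).  Both records apply `hC` ONLY at
the row pair (`KatoDescentKMCImpReading.rankOne_missingPPartAt_of_kmcImp_of_perrinRiou`, l.129), and ON THE ROWS the
reading is a tree theorem modulo print facts (`StrictCount.rankOneCountReading_classCSeven_of_facts` /
`…_istarZero_of_facts`, `Rank1Residual/Additive/KatoDescentRankOneCountRows.lean`, p719298: ⟸ {GZK, lev,
`Kato2004.thm12_4`, H2X′}).  This file supplies the ONE missing brick for the planner's restub (D679): the descent
with `hC` / `hreal` replaced by their VALUES AT `(W, p)` (§1), and the two compositions with `hC` replaced by a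
ROW-KEYED count hypothesis of exactly the rows' shape — `hC7` on 𝒞₇ × {7}, `hCrows` on the signed types
`(p, I₀*)`, `p ≥ 5` — `hreal` kept VERBATIM (§2 over the interface binders `IsOf` / `PRRatio` / `KMC` with the
`→`-only reading binder `hread`; §3 at the PRINT-EXACT closed triple `(IsKatoZetaDescentDatumOfContra, Kato2004.PRRatio,
KatoMainConjectureFineContra)` with `hread` DISCHARGED by the kernel lemma
`conj1210_of_isKatoZetaDescentDatumOfContra_of_katoMainConjectureFineContra`, p628155).  With §3 and p719298 /
its by-name re-key `KatoDescentRankOneCountRowsNamed.lean`, a skeleton whose count stub is keyed to the rows closes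
stubs 3/4 in-file from a PURE-CITE stub `Kato2004.thm12_4 ∧ Kato2004.exists_iwasawaH2Data_fineSelmerDual_embedding_loc ∧
lev` (planner's zp v5 / istar v5 touch; this file registers nothing).
* §1 `rankOne_missingPPartAt_of_countAt` (ns `…Rank1Residual.Additive.KMCImpReadingPointwise` throughout) — `(hcount)` = the count reading AT `(W, p)`
  (`∀ D ℒ, IsOf W p D → PRRatio W p ℒ → ⟨finite ∧ iff ∧ valuation⟩`), `(hrealAt : KMC W p → ∃ D, IsOf W p D)`, the
  binder `hread`, GZK, modularity, `r_an = 1`, `p ∤ #W(ℚ)_tors`, PR^×(W, p), KMC(W, p) ⟹ `MissingPPartAt W p`; same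
  12-line proof as the generic record (`Finite Ш` from GZK inside); `rankOne_bsdp_of_countAt`.
* §2 `valueSevenOfGZK_of_rowCount_of_perrinRiou (hC7) (hreal) (hread) (hmod) (hCassels) (hKMC) (hPR)`
  and `cccOneLawOnTypeIstarZero_of_rowCount_of_perrinRiou (hCrows) (hreal) (hread) (hKMC) (hPR) (h₅) (h₆)`
  — the cruxes BY NAME; side conditions by the records' §0 lemmas (`ValueOfKMCPerrinRiou.addv_seven` /
  `padicValRat_j_nonneg` / `not_seven_dvd_torsionOrder`; `CccOneKMCPerrinRiou.addv_and_j_nonneg_and_not_dvd_torsionOrder_of_hasSignedLocalType`).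
* §3 the same two at the closed triple: `valueSevenOfGZK_of_rowCount_of_kmcFineContra_of_perrinRiouRatio`,
  `cccOneLawOnTypeIstarZero_of_rowCount_of_kmcFineContra_of_perrinRiouRatio` — hypotheses = a row-keyed stub 3
  (= p719298's conclusions VERBATIM), stub 4 VERBATIM, stubs 1, 2, 6 VERBATIM; and the `…_of_rowCountOfGZK_…` twins with
  the row-keyed stub 3 GUARDED by `GZK →` (GZK = 19945's antecedent / the conjunct `PublishedFactsInert.2.2.1` on 19223).
HONEST LABEL: every statement is CONDITIONAL on displayed hypotheses (the row count reading, the realisation reading,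
GZK, modularity, Cassels / the K8 support items, KMC and PR^× on the rows); no definition, no named fact, no instance,
no `sorry`; the cruxes are concluded BY NAME, never restated; 19945 / 19223 stay OPEN; no summit statement is proved;
BSD is not proved for any curve by any of this.
[cite: BurnsKuriharaSano2019, Thm. 7.3 and Thm. 7.6 (p. 29), Conj. 2.8 (p. 10)]
[cite: Kato2004Asterisque, Conj. 12.10 (p. 224), §14.14 and Lemma 14.15 (pp. 243–244), Prop. 14.16 (p. 244)]
[cite: Miller2011LMS, §1 and Def. 1.1] [cite: Cassels1965ArithmeticVIII] [cite: Kobayashi2003, §4 (p. 8), Thm. 7.4 (p. 13)]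
-/

noncomputable section

open scoped Classical NumberField

open WeierstrassCurve Literature.NumberTheory.EllipticCurves
  Literature.NumberTheory.EllipticCurves.Rank1Residual
  Literature.NumberTheory.EllipticCurves.Rank1Residual.Typed
  Literature.NumberTheory.EllipticCurves.IwasawaAlgebra
open Summit.BirchSwinnertonDyer.Rank1Residual
open Summit.BirchSwinnertonDyer.Rank1Residual.Additive
open Summit.BirchSwinnertonDyer.Rank1Residual.X12.O10
open Summit.BirchSwinnertonDyer.Rank1Residual.X12.O11
open Summit.BirchSwinnertonDyer.BirchSwinnertonDyer.Theses.RamifiedSevenEllipticUnits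
open Summit.BirchSwinnertonDyer.BirchSwinnertonDyer.Theses.InertBadSignedBranches
open Summit.BirchSwinnertonDyer.BirchSwinnertonDyer.Theorems
open Summit.BirchSwinnertonDyer.BirchSwinnertonDyer.Theorems.CccOneLowerHalf
open Summit.BirchSwinnertonDyer.BirchSwinnertonDyer.Theorems.RamifiedSevenEllipticUnits

namespace Summit.BirchSwinnertonDyer.Rank1Residual.Additive.KMCImpReadingPointwise

/-! ## §1 The rank-one descent with the readings taken pointwise at `(W, p)` -/

section Pointwise

variable {IsOf : ∀ (W : WeierstrassCurve ℚ) [W.IsElliptic] [W.IsGloballyMinimal] (p : ℕ) [Fact p.Prime],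
  KatoDescentDatum p → Prop}
variable {PRRatio : ∀ (W : WeierstrassCurve ℚ) [W.IsElliptic] [W.IsGloballyMinimal] (p : ℕ)
  [Fact p.Prime], ℚ_[p] → Prop}
variable {KMC : ∀ (W : WeierstrassCurve ℚ) [W.IsElliptic] [W.IsGloballyMinimal] (p : ℕ), Prop}
variable (W : WeierstrassCurve ℚ) [W.IsElliptic] [W.IsGloballyMinimal] (p : ℕ) [Fact p.Prime]

omit [W.IsElliptic] [W.IsGloballyMinimal] in
/-- `ord_p #Ш(E)(p) = ord_p #Ш(E)`. [folklore] -/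
private theorem padicValNat_primaryComponent_sha' (hfin : Finite W.sha) :
    padicValNat p (Nat.card (AddCommGroup.primaryComponent W.sha p)) = padicValNat p W.shaOrder := by
  haveI := hfin
  unfold WeierstrassCurve.shaOrder
  exact padicValNat_card_addPrimaryComponent p

/-- **Rank ONE at a torsion-free member, readings POINTWISE: the count reading AT `(W, p)`, the realisation
AT `(W, p)`, the `→`-only binder, GZK, modularity, PR^×(W, p), KMC(W, p) ⟹ `MissingPPartAt W p`** — the record
`rankOne_missingPPartAt_of_kmcImp_of_perrinRiou` (Burns–Kurihara–Sano Thm. 7.6 at `r = 1` in Kato's `𝐇²`-formalism)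
with `hC W p` / `hreal W p hp hadd hj ht` replaced by their VALUES at the pair; same proof (`Finite Ш` from GZK inside).
CONDITIONAL. [cite: BurnsKuriharaSano2019, Thm. 7.6 and Remark 7.7 (p. 29)] [cite: Kato2004Asterisque, Conj. 12.10 (p. 224), §14.14 (p. 243)] -/
theorem rankOne_missingPPartAt_of_countAt
    (hcount : ∀ (D : KatoDescentDatum p) (ℒ : ℚ_[p]), IsOf W p D → PRRatio W p ℒ →
      Finite (coinvariants p D.H2) ∧ (ℒ ≠ 0 ↔ D.zetaIndex ≠ 0) ∧
        ∀ m : ℕ, D.zetaIndex = p ^ m * D.h2Card →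
          ℒ.valuation = (m : ℤ) +
            padicValNat p (Nat.card (AddCommGroup.primaryComponent W.sha p)) +
            padicValNat p W.tamagawaProduct)
    (hrealAt : KMC W p → ∃ D : KatoDescentDatum p, IsOf W p D)
    (hread : ∀ (W : WeierstrassCurve ℚ) [W.IsElliptic] [W.IsGloballyMinimal] (p : ℕ) [Fact p.Prime]
      (D : KatoDescentDatum p), IsOf W p D → KMC W p → D.Conj1210)
    (hGZK : rank_eq_analyticRank_of_analyticRank_le_one) (hmod : hasEntireLFunction_rat)
    (hr : W.analyticRank = 1) (ht : ¬ p ∣ W.torsionOrder) (hPR : PerrinRiouUpToUnitAt PRRatio W p)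
    (hKMC : KMC W p) : MissingPPartAt W p := by
  have hfin : Finite W.sha := (hGZK W (by rw [hr])).2
  obtain ⟨D, hDof⟩ := hrealAt hKMC
  obtain ⟨ℒ, hℒ, -, q, hq, hv⟩ := hPR hr
  obtain ⟨hfinH2, -, hcount'⟩ := hcount D ℒ hDof hℒ
  have hμ : D.zetaIndex = D.h2Card :=
    D.zetaIndex_eq_h2Card_of_conj1210 hfinH2 (hread W p D hDof hKMC)
  have hval := hcount' 0 (by rw [pow_zero, one_mul]; exact hμ)
  obtain ⟨q', hq', hv'⟩ := TorsionFree.exists_shaAn_eq_of_leadingTerm_eq W p ht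
    (W.leadingLCoeff_ne_zero_holds (hmod W)) hq
  refine ⟨q', hq', ?_⟩
  rw [hv', ← hv, hval, padicValNat_primaryComponent_sha' W p hfin]
  push_cast
  ring

/-- **… and `BSD(W, p)` itself** (Miller's `BSDp`; `Ш(W)` finite and `rank = r_an` by GZK).
[cite: BurnsKuriharaSano2019, Thm. 7.6 (p. 29)] [cite: Miller2011LMS, §1 and Def. 1.1] -/
theorem rankOne_bsdp_of_countAt
    (hcount : ∀ (D : KatoDescentDatum p) (ℒ : ℚ_[p]), IsOf W p D → PRRatio W p ℒ →
      Finite (coinvariants p D.H2) ∧ (ℒ ≠ 0 ↔ D.zetaIndex ≠ 0) ∧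
        ∀ m : ℕ, D.zetaIndex = p ^ m * D.h2Card →
          ℒ.valuation = (m : ℤ) +
            padicValNat p (Nat.card (AddCommGroup.primaryComponent W.sha p)) +
            padicValNat p W.tamagawaProduct)
    (hrealAt : KMC W p → ∃ D : KatoDescentDatum p, IsOf W p D)
    (hread : ∀ (W : WeierstrassCurve ℚ) [W.IsElliptic] [W.IsGloballyMinimal] (p : ℕ) [Fact p.Prime]
      (D : KatoDescentDatum p), IsOf W p D → KMC W p → D.Conj1210)
    (hGZK : rank_eq_analyticRank_of_analyticRank_le_one) (hmod : hasEntireLFunction_rat)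
    (hr : W.analyticRank = 1) (ht : ¬ p ∣ W.torsionOrder) (hPR : PerrinRiouUpToUnitAt PRRatio W p)
    (hKMC : KMC W p) : BSDp W p :=
  bsdp_of_missingPPartAt W p hGZK (by rw [hr])
    (rankOne_missingPPartAt_of_countAt W p hcount hrealAt hread hGZK hmod hr ht hPR hKMC)

end Pointwise

/-! ## §2 The two cruxes BY NAME from a ROW-KEYED count reading, over the interface binders -/

section RowKeyed

variable {IsOf : ∀ (W : WeierstrassCurve ℚ) [W.IsElliptic] [W.IsGloballyMinimal] (p : ℕ) [Fact p.Prime],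
  KatoDescentDatum p → Prop}
variable {PRRatio : ∀ (W : WeierstrassCurve ℚ) [W.IsElliptic] [W.IsGloballyMinimal] (p : ℕ)
  [Fact p.Prime], ℚ_[p] → Prop}
variable {KMC : ∀ (W : WeierstrassCurve ℚ) [W.IsElliptic] [W.IsGloballyMinimal] (p : ℕ), Prop}

/-- **Crux 19945 `EllipticUnitValueSevenOfGZK` ⟸ KMC(T₇W) ∧ PR^×(W, 7) at every `W ∈ 𝒞₇`, the count reading keyed
TO THE ROWS** (`hC7`: the body of `TorsionFree.RankOneCountReading IsOf PRRatio` at `(W, 7)`, `W ∈ 𝒞₇`, with its row side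
conditions already discharged — the shape of `StrictCount.rankOneCountReading_classCSeven_of_facts`), `hreal` / `hread` /
modularity / Cassels as in `ValueOfKMCImpReading.valueSevenOfGZK_of_kmcImp_of_perrinRiou`; GZK is the crux's own antecedent.
Per member: §1 + `bsdp_of_missingPPartAt` + `RubinFormulaZpBsdp.ramifiedCMBottomClassIndexLawAtZp_of_bsdp`.  The crux is
concluded BY NAME.  CONDITIONAL; nothing booked; 19945 stays OPEN.
[cite: BurnsKuriharaSano2019, Thm. 7.6 (p. 29)] [cite: Kato2004Asterisque, Conj. 12.10 (p. 224), §15] [cite: Cassels1965ArithmeticVIII] -/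
theorem valueSevenOfGZK_of_rowCount_of_perrinRiou
    (hC7 : ∀ (W : WeierstrassCurve ℚ) [W.IsElliptic] [W.IsGloballyMinimal] [Fact (Nat.Prime 7)],
      X12.ClassCSeven W →
      ∀ (D : KatoDescentDatum 7) (ℒ : ℚ_[7]), IsOf W 7 D → PRRatio W 7 ℒ →
        Finite (coinvariants 7 D.H2) ∧ (ℒ ≠ 0 ↔ D.zetaIndex ≠ 0) ∧
          ∀ m : ℕ, D.zetaIndex = 7 ^ m * D.h2Card →
            ℒ.valuation = (m : ℤ) +
              padicValNat 7 (Nat.card (AddCommGroup.primaryComponent W.sha 7)) +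
              padicValNat 7 W.tamagawaProduct)
    (hreal : TorsionFree.RealizableOfKMC IsOf KMC)
    (hread : ∀ (W : WeierstrassCurve ℚ) [W.IsElliptic] [W.IsGloballyMinimal] (p : ℕ) [Fact p.Prime]
      (D : KatoDescentDatum p), IsOf W p D → KMC W p → D.Conj1210)
    (hmod : hasEntireLFunction_rat) (hCassels : bsdRHS_eq_of_isIsogenous)
    (hKMC : ∀ (W : WeierstrassCurve ℚ) [W.IsElliptic] [W.IsGloballyMinimal] [Fact (Nat.Prime 7)],
      X12.ClassCSeven W → KMC W 7)
    (hPR : ∀ (W : WeierstrassCurve ℚ) [W.IsElliptic] [W.IsGloballyMinimal] [Fact (Nat.Prime 7)],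
      X12.ClassCSeven W → PerrinRiouUpToUnitAt PRRatio W 7) :
    EllipticUnitValueSevenOfGZK :=
  fun hGZK W _ _ _ h7 ↦
    RubinFormulaZpBsdp.ramifiedCMBottomClassIndexLawAtZp_of_bsdp hCassels hmod hGZK
      (le_of_eq h7.2.2.1)
      (rankOne_bsdp_of_countAt W 7 (hC7 W h7)
        (fun hK ↦ hreal W 7 (by norm_num) (ValueOfKMCPerrinRiou.addv_seven W h7)
          (ValueOfKMCPerrinRiou.padicValRat_j_nonneg W h7) (ValueOfKMCPerrinRiou.not_seven_dvd_torsionOrder W h7) hK)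
        hread hGZK hmod h7.2.2.1 (ValueOfKMCPerrinRiou.not_seven_dvd_torsionOrder W h7)
        (hPR W h7) (hKMC W h7))

/-- **Crux 19223 `CccOneLawOnTypeIstarZero` ⟸ KMC(T_pW) ∧ PR^×(W, p) at every rank-one pair of the type `(p, I₀*)`, `p ≥ 5`,
the count reading keyed TO THE ROWS** (`hCrows`: the body of `TorsionFree.RankOneCountReading IsOf PRRatio` at the pairs of the
type, row side conditions discharged — the shape of `StrictCount.rankOneCountReading_istarZero_of_facts`), `hreal` / `hread` and
the route's support items `PrintReadingsInert` / `PublishedFactsInert` as in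
`CccOneKMCImpReading.cccOneLawOnTypeIstarZero_of_kmcImp_of_perrinRiou`.  Per pair: §1 + `bsdp_of_missingPPartAt`, then
`cccOneLawOnTypeIstarZero_of_bsdpOnType`.  The crux is concluded BY NAME.  CONDITIONAL; nothing booked; 19223 stays OPEN.
[cite: BurnsKuriharaSano2019, Thm. 7.6 (p. 29)] [cite: Kato2004Asterisque, Conj. 12.10 (p. 224), §15] [cite: Kobayashi2003, §4 (p. 8), Thm. 7.4 (p. 13)] -/
theorem cccOneLawOnTypeIstarZero_of_rowCount_of_perrinRiou
    (hCrows : ∀ (p : ℕ) [Fact p.Prime], 5 ≤ p → ∀ (W : WeierstrassCurve ℚ) [W.IsElliptic] [W.IsGloballyMinimal],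
      HasSignedLocalType W p (.Istar 0) → W.analyticRank = 1 →
      ∀ (D : KatoDescentDatum p) (ℒ : ℚ_[p]), IsOf W p D → PRRatio W p ℒ →
        Finite (coinvariants p D.H2) ∧ (ℒ ≠ 0 ↔ D.zetaIndex ≠ 0) ∧
          ∀ m : ℕ, D.zetaIndex = p ^ m * D.h2Card →
            ℒ.valuation = (m : ℤ) +
              padicValNat p (Nat.card (AddCommGroup.primaryComponent W.sha p)) +
              padicValNat p W.tamagawaProduct)
    (hreal : TorsionFree.RealizableOfKMC IsOf KMC)
    (hread : ∀ (W : WeierstrassCurve ℚ) [W.IsElliptic] [W.IsGloballyMinimal] (p : ℕ) [Fact p.Prime]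
      (D : KatoDescentDatum p), IsOf W p D → KMC W p → D.Conj1210)
    (hKMC : ∀ (p : ℕ) [Fact p.Prime], 5 ≤ p → ∀ (W : WeierstrassCurve ℚ) [W.IsElliptic]
      [W.IsGloballyMinimal], HasSignedLocalType W p (.Istar 0) → W.analyticRank = 1 → KMC W p)
    (hPR : ∀ (p : ℕ) [Fact p.Prime], 5 ≤ p → ∀ (W : WeierstrassCurve ℚ) [W.IsElliptic]
      [W.IsGloballyMinimal], HasSignedLocalType W p (.Istar 0) → W.analyticRank = 1 →
      PerrinRiouUpToUnitAt PRRatio W p)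
    (h₅ : PrintReadingsInert) (h₆ : PublishedFactsInert) : CccOneLawOnTypeIstarZero := by
  obtain ⟨hmod, -, hGZK, hPT, -, -⟩ := h₆
  refine cccOneLawOnTypeIstarZero_of_bsdpOnType h₅ hmod hGZK hPT fun p _ hp5 W _ _ hT hr ↦ ?_
  obtain ⟨haddv, hj, htors⟩ :=
    CccOneKMCPerrinRiou.addv_and_j_nonneg_and_not_dvd_torsionOrder_of_hasSignedLocalType W p (by omega) hT
  exact rankOne_bsdp_of_countAt W p (hCrows p hp5 W hT hr)
    (fun hK ↦ hreal W p (by omega) haddv hj htors hK) hread hGZK hmod hr htors (hPR p hp5 W hT hr)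
    (hKMC p hp5 W hT hr)

end RowKeyed

/-! ## §3 At the PRINT-EXACT closed triple `(IsKatoZetaDescentDatumOfContra, Kato2004.PRRatio, KatoMainConjectureFineContra)` -/

section Closed

/-- **Crux 19945 BY NAME from a ROW-KEYED stub 3 (= `StrictCount.rankOneCountReading_classCSeven_of_facts`'s conclusion
VERBATIM), stub 4 VERBATIM, stubs 1, 2, 6 VERBATIM** (v4 keys; the `→`-only reading DISCHARGED by
`conj1210_of_isKatoZetaDescentDatumOfContra_of_katoMainConjectureFineContra`, p628155).  Intended as the composition term of
the planner's zp v5 (this file registers nothing).  CONDITIONAL on the displayed hypotheses; 19945 stays OPEN; BSD is not proved.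
[cite: BurnsKuriharaSano2019, Thm. 7.6 (p. 29), Conj. 2.8 (ii) (p. 10)] [cite: Kato2004Asterisque, Conj. 12.10 (p. 224), §14.14 (p. 243)]
[cite: Cassels1965ArithmeticVIII] -/
theorem valueSevenOfGZK_of_rowCount_of_kmcFineContra_of_perrinRiouRatio
    (hC7 : ∀ (W : WeierstrassCurve ℚ) [W.IsElliptic] [W.IsGloballyMinimal] [Fact (Nat.Prime 7)],
      X12.ClassCSeven W →
      ∀ (D : KatoDescentDatum 7) (ℒ : ℚ_[7]),
        IsKatoZetaDescentDatumOfContra W 7 D → Kato2004.PRRatio W 7 ℒ →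
        Finite (coinvariants 7 D.H2) ∧ (ℒ ≠ 0 ↔ D.zetaIndex ≠ 0) ∧
          ∀ m : ℕ, D.zetaIndex = 7 ^ m * D.h2Card →
            ℒ.valuation = (m : ℤ) +
              padicValNat 7 (Nat.card (AddCommGroup.primaryComponent W.sha 7)) +
              padicValNat 7 W.tamagawaProduct)
    (hreal : TorsionFree.RealizableOfKMC IsKatoZetaDescentDatumOfContra KatoMainConjectureFineContra)
    (hmod : hasEntireLFunction_rat) (hCassels : bsdRHS_eq_of_isIsogenous)
    (hKMC : ∀ (W : WeierstrassCurve ℚ) [W.IsElliptic] [W.IsGloballyMinimal] [Fact (Nat.Prime 7)],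
      X12.ClassCSeven W → KatoMainConjectureFineContra W 7)
    (hPR : ∀ (W : WeierstrassCurve ℚ) [W.IsElliptic] [W.IsGloballyMinimal] [Fact (Nat.Prime 7)],
      X12.ClassCSeven W → PerrinRiouUpToUnitAt Kato2004.PRRatio W 7) :
    EllipticUnitValueSevenOfGZK :=
  valueSevenOfGZK_of_rowCount_of_perrinRiou hC7 hreal
    (fun _ _ _ _ _ _ hD hK ↦ conj1210_of_isKatoZetaDescentDatumOfContra_of_katoMainConjectureFineContra hD hK)
    hmod hCassels hKMC hPR

/-- **Crux 19223 BY NAME from a ROW-KEYED stub 3 (= `StrictCount.rankOneCountReading_istarZero_of_facts`'s conclusion VERBATIM),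
stub 4 VERBATIM, stubs 1, 2, 6 VERBATIM** (v4 keys; the `→`-only reading DISCHARGED as above).  Intended as the composition term of
the planner's istar v5 (this file registers nothing).  CONDITIONAL; 19223 stays OPEN; BSD is not proved.
[cite: BurnsKuriharaSano2019, Thm. 7.6 (p. 29), Conj. 2.8 (ii) (p. 10)] [cite: Kato2004Asterisque, Conj. 12.10 (p. 224), §14.14 (p. 243)]
[cite: Kobayashi2003, §4 (p. 8), Thm. 7.4 (p. 13)] -/
theorem cccOneLawOnTypeIstarZero_of_rowCount_of_kmcFineContra_of_perrinRiouRatio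
    (hCrows : ∀ (p : ℕ) [Fact p.Prime], 5 ≤ p → ∀ (W : WeierstrassCurve ℚ) [W.IsElliptic] [W.IsGloballyMinimal],
      HasSignedLocalType W p (.Istar 0) → W.analyticRank = 1 →
      ∀ (D : KatoDescentDatum p) (ℒ : ℚ_[p]),
        IsKatoZetaDescentDatumOfContra W p D → Kato2004.PRRatio W p ℒ →
        Finite (coinvariants p D.H2) ∧ (ℒ ≠ 0 ↔ D.zetaIndex ≠ 0) ∧
          ∀ m : ℕ, D.zetaIndex = p ^ m * D.h2Card →
            ℒ.valuation = (m : ℤ) +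
              padicValNat p (Nat.card (AddCommGroup.primaryComponent W.sha p)) +
              padicValNat p W.tamagawaProduct)
    (hreal : TorsionFree.RealizableOfKMC IsKatoZetaDescentDatumOfContra KatoMainConjectureFineContra)
    (hKMC : ∀ (p : ℕ) [Fact p.Prime], 5 ≤ p → ∀ (W : WeierstrassCurve ℚ) [W.IsElliptic]
      [W.IsGloballyMinimal], HasSignedLocalType W p (.Istar 0) → W.analyticRank = 1 →
      KatoMainConjectureFineContra W p)
    (hPR : ∀ (p : ℕ) [Fact p.Prime], 5 ≤ p → ∀ (W : WeierstrassCurve ℚ) [W.IsElliptic]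
      [W.IsGloballyMinimal], HasSignedLocalType W p (.Istar 0) → W.analyticRank = 1 →
      PerrinRiouUpToUnitAt Kato2004.PRRatio W p)
    (h₅ : PrintReadingsInert) (h₆ : PublishedFactsInert) : CccOneLawOnTypeIstarZero :=
  cccOneLawOnTypeIstarZero_of_rowCount_of_perrinRiou hCrows hreal
    (fun _ _ _ _ _ _ hD hK ↦ conj1210_of_isKatoZetaDescentDatumOfContra_of_katoMainConjectureFineContra hD hK)
    hKMC hPR h₅ h₆

/-- **Crux 19945 BY NAME with the row-keyed stub 3 GUARDED BY GZK** (`hC7 : GZK → …`, the shape produced by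
`StrictCount.rankOneCountReading_classCSeven_of_named_facts · hlev h12 hloc` with GZK left open — GZK is the crux's own
antecedent, so no GZK input is needed in the skeleton).  CONDITIONAL; 19945 stays OPEN; BSD is not proved.
[cite: BurnsKuriharaSano2019, Thm. 7.6 (p. 29)] [cite: Kato2004Asterisque, Conj. 12.10 (p. 224), §14.14 (p. 243)] -/
theorem valueSevenOfGZK_of_rowCountOfGZK_of_kmcFineContra_of_perrinRiouRatio
    (hC7 : rank_eq_analyticRank_of_analyticRank_le_one →
      ∀ (W : WeierstrassCurve ℚ) [W.IsElliptic] [W.IsGloballyMinimal] [Fact (Nat.Prime 7)],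
      X12.ClassCSeven W →
      ∀ (D : KatoDescentDatum 7) (ℒ : ℚ_[7]),
        IsKatoZetaDescentDatumOfContra W 7 D → Kato2004.PRRatio W 7 ℒ →
        Finite (coinvariants 7 D.H2) ∧ (ℒ ≠ 0 ↔ D.zetaIndex ≠ 0) ∧
          ∀ m : ℕ, D.zetaIndex = 7 ^ m * D.h2Card →
            ℒ.valuation = (m : ℤ) +
              padicValNat 7 (Nat.card (AddCommGroup.primaryComponent W.sha 7)) +
              padicValNat 7 W.tamagawaProduct)
    (hreal : TorsionFree.RealizableOfKMC IsKatoZetaDescentDatumOfContra KatoMainConjectureFineContra)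
    (hmod : hasEntireLFunction_rat) (hCassels : bsdRHS_eq_of_isIsogenous)
    (hKMC : ∀ (W : WeierstrassCurve ℚ) [W.IsElliptic] [W.IsGloballyMinimal] [Fact (Nat.Prime 7)],
      X12.ClassCSeven W → KatoMainConjectureFineContra W 7)
    (hPR : ∀ (W : WeierstrassCurve ℚ) [W.IsElliptic] [W.IsGloballyMinimal] [Fact (Nat.Prime 7)],
      X12.ClassCSeven W → PerrinRiouUpToUnitAt Kato2004.PRRatio W 7) :
    EllipticUnitValueSevenOfGZK :=
  fun hGZK ↦ valueSevenOfGZK_of_rowCount_of_kmcFineContra_of_perrinRiouRatio (hC7 hGZK) hreal hmod hCassels hKMC hPR hGZK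

/-- **Crux 19223 BY NAME with the row-keyed stub 3 GUARDED BY GZK** (`hCrows : GZK → …`; GZK is the conjunct
`PublishedFactsInert.2.2.1` of the route's support item, so no separate GZK input is needed in the skeleton).  CONDITIONAL;
19223 stays OPEN; BSD is not proved. [cite: BurnsKuriharaSano2019, Thm. 7.6 (p. 29)] [cite: Kobayashi2003, §4 (p. 8), Thm. 7.4 (p. 13)] -/
theorem cccOneLawOnTypeIstarZero_of_rowCountOfGZK_of_kmcFineContra_of_perrinRiouRatio
    (hCrows : rank_eq_analyticRank_of_analyticRank_le_one →
      ∀ (p : ℕ) [Fact p.Prime], 5 ≤ p → ∀ (W : WeierstrassCurve ℚ) [W.IsElliptic] [W.IsGloballyMinimal],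
      HasSignedLocalType W p (.Istar 0) → W.analyticRank = 1 →
      ∀ (D : KatoDescentDatum p) (ℒ : ℚ_[p]),
        IsKatoZetaDescentDatumOfContra W p D → Kato2004.PRRatio W p ℒ →
        Finite (coinvariants p D.H2) ∧ (ℒ ≠ 0 ↔ D.zetaIndex ≠ 0) ∧
          ∀ m : ℕ, D.zetaIndex = p ^ m * D.h2Card →
            ℒ.valuation = (m : ℤ) +
              padicValNat p (Nat.card (AddCommGroup.primaryComponent W.sha p)) +
              padicValNat p W.tamagawaProduct)
    (hreal : TorsionFree.RealizableOfKMC IsKatoZetaDescentDatumOfContra KatoMainConjectureFineContra)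
    (hKMC : ∀ (p : ℕ) [Fact p.Prime], 5 ≤ p → ∀ (W : WeierstrassCurve ℚ) [W.IsElliptic]
      [W.IsGloballyMinimal], HasSignedLocalType W p (.Istar 0) → W.analyticRank = 1 →
      KatoMainConjectureFineContra W p)
    (hPR : ∀ (p : ℕ) [Fact p.Prime], 5 ≤ p → ∀ (W : WeierstrassCurve ℚ) [W.IsElliptic]
      [W.IsGloballyMinimal], HasSignedLocalType W p (.Istar 0) → W.analyticRank = 1 →
      PerrinRiouUpToUnitAt Kato2004.PRRatio W p)
    (h₅ : PrintReadingsInert) (h₆ : PublishedFactsInert) : CccOneLawOnTypeIstarZero :=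
  cccOneLawOnTypeIstarZero_of_rowCount_of_kmcFineContra_of_perrinRiouRatio (hCrows h₆.2.2.1) hreal hKMC hPR h₅ h₆

end Closed

end Summit.BirchSwinnertonDyer.Rank1Residual.Additive.KMCImpReadingPointwise

end
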